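import Summits.Ventures.YMGap.Thresholds.StarGaugeReceivedSum
import Mathlib.Data.Fintype.Prod
import HarnessLib

/-!
# Venture YMGap — track (c) «DS», brick B4b part A: the Lemma-G super-solution and count on the
# ABSTRACT star `Fin 4 × Bool` (direction, orientation) — pure combinatorics + arithmetic

HONEST FRAMING: venture file (cell `pub-ymgap`, PLAN R95/R96 K-row), strong-coupling LATTICE
bookkeeping; NO measure, NO torus, NO estimate of a kernel.  The vertex star of a site of `(ℤ/L)^4`
has `8` links, labelled here abstractly by `(μ, o) : Fin 4 × Bool` (direction `μ`, outgoing/incoming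
`o`); two star links share a plaquette iff their directions differ (`StarAdjacency`, p3).  For an
ordered pair `(a, b)` of star links with `a.1 ≠ b.1` (the two star links of the plaquette carrying the
perturbed boundary link, gauge fixed at `a`), Lemma G's super-solution (`GAUGE-STAR.md` §4,
`B4-BLUEPRINT.md` §2–§4) assigns to a star link `z ≠ a` the resolvent entry

  `Dpos c a b z = D_bb` if `z = b`, `D_b̄b` if `z` is opposite to `b`, `D_āb` if `z` is opposite to `a`,
  `D_gb` otherwise   (`StarWindowGauge.Dbb/Dbbar/Dabar/Dgen`, `c = β_W/4`).

This file proves the two finite identities the assembly `starWindowBound_lemmaG` needs, with the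
combinatorial counting done by `decide` on position-class counts and the arithmetic by the column
equations `StarWindowGauge.colB_eq_*`:

* `col_superSolution` — for `a.1 ≠ b.1`, `x ≠ a`, `0 ≤ c ≤ 7/40`:
  `[x = b] + c · Σ_{z ≠ a, z.1 ≠ x.1} Dpos c a b z = Dpos c a b x`
  (the hypothesis `hsol` of the window comparison: the perturbed boundary link touches `x` iff `x = b`,
  and `z` influences `x` iff `z.1 ≠ x.1`);
* `sum_pairs_Dpos` — for every star link `x`:
  `Σ_{(a,b) : a.1 ≠ b.1, a ≠ x} Dpos c a b x = 6 D_bb + 6 D_āb + 6 D_b̄b + 24 D_gb`, hence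
  `= gaugeR β / c`-shaped via `StarWindowGauge.gaugeR_eq_count` (`received_sum_eq_gaugeR`).

NOT here: the identification of the abstract labels with the torus links (`StarAdjacency.starLink`),
the window kernels, the comparison theorem — bricks B1/B3″/B4b. Nothing about the continuum or the
mass gap.
-/

noncomputable section

open Finset

namespace Summit.Ventures.YMGap.StarColumn

open Summit.Ventures.YMGap.StarWindowGauge

/-- Abstract star-link labels: (direction, orientation). -/
abbrev Dir := Fin 4 × Bool

/-! ### Position classes and their counts (decidable combinatorics) -/

/-- Position class of the star link `z` relative to the ordered pair `(a, b)`: `0` = `z = b`,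
`1` = opposite to `b` (same direction, `z ≠ b`), `2` = direction of `a`, `3` = generic. [folklore] -/
def pos (a b z : Dir) : Fin 4 :=
  if z = b then 0 else if z.1 = b.1 then 1 else if z.1 = a.1 then 2 else 3

/-- The set over which the super-solution inequality sums: star links `z ≠ a` not collinear with `x`
(`z.1 ≠ x.1`, i.e. sharing a plaquette with `x`). [folklore] -/
def colSet (a x : Dir) : Finset Dir :=
  univ.filter fun z => z ≠ a ∧ z.1 ≠ x.1

/-- Number of links of `colSet a x` in position class `k`. [folklore] -/
def cnt (a b x : Dir) (k : Fin 4) : ℕ :=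
  ((colSet a x).filter fun z => pos a b z = k).card

/-- Counts when `x` is the partner `b` or its opposite: `(0, 0, 1, 4)`. [folklore] -/
theorem cnt_of_fst_eq : ∀ a b x : Dir, a.1 ≠ b.1 → x ≠ a → x.1 = b.1 →
    cnt a b x 0 = 0 ∧ cnt a b x 1 = 0 ∧ cnt a b x 2 = 1 ∧ cnt a b x 3 = 4 := by
  decide

/-- Counts when `x` is opposite to the frozen link `a`: `(1, 1, 0, 4)`. [folklore] -/
theorem cnt_of_fst_eq_fst : ∀ a b x : Dir, a.1 ≠ b.1 → x ≠ a → x.1 = a.1 →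
    cnt a b x 0 = 1 ∧ cnt a b x 1 = 1 ∧ cnt a b x 2 = 0 ∧ cnt a b x 3 = 4 := by
  decide

/-- Counts when `x` is generic: `(1, 1, 1, 2)`. [folklore] -/
theorem cnt_of_generic : ∀ a b x : Dir, a.1 ≠ b.1 → x.1 ≠ a.1 → x.1 ≠ b.1 →
    cnt a b x 0 = 1 ∧ cnt a b x 1 = 1 ∧ cnt a b x 2 = 1 ∧ cnt a b x 3 = 2 := by
  decide

/-- The ordered pairs `(a, b)` of non-collinear star links with `a ≠ x`. [folklore] -/
def pairSet (x : Dir) : Finset (Dir × Dir) :=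
  univ.filter fun p => p.1.1 ≠ p.2.1 ∧ p.1 ≠ x

/-- Number of such pairs seeing `x` in position class `k`. [folklore] -/
def cnt2 (x : Dir) (k : Fin 4) : ℕ :=
  ((pairSet x).filter fun p => pos p.1 p.2 x = k).card

/-- **The 48-position count**: `x` is the partner for `6` ordered pairs, opposite-to-the-partner for
`6`, opposite-to-the-frozen-link for `6`, generic for `24`. [folklore] -/
theorem cnt2_eq : ∀ x : Dir, cnt2 x 0 = 6 ∧ cnt2 x 1 = 6 ∧ cnt2 x 2 = 6 ∧ cnt2 x 3 = 24 := by
  decide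

/-! ### The resolvent column by position and the fiberwise sums -/

/-- The value of the resolvent column in position class `k`. [folklore] -/
def colVal (c : ℝ) (k : Fin 4) : ℝ :=
  if k = 0 then Dbb c else if k = 1 then Dbbar c else if k = 2 then Dabar c else Dgen c

/-- **The super-solution entry** `D^{(a)}(z; b)` of Lemma G at the star link `z` (meaningful for
`z ≠ a`): `D_bb` at the partner, `D_b̄b` opposite to it, `D_āb` opposite to the frozen link, `D_gb`
at the four generic links. [folklore] -/
def Dpos (c : ℝ) (a b z : Dir) : ℝ :=
  colVal c (pos a b z)

/-- `Dpos` is nonnegative below the pole (`0 ≤ c ≤ 7/40`). [folklore] -/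
theorem Dpos_nonneg {c : ℝ} (h0 : 0 ≤ c) (h1 : c ≤ 7 / 40) (a b z : Dir) : 0 ≤ Dpos c a b z := by
  obtain ⟨hb, hbb, hab, hg⟩ := colB_nonneg h0 h1
  unfold Dpos colVal
  split_ifs <;> assumption

/-- A sum of `Dpos` over a set is the count-weighted sum of the four column values. [folklore] -/
theorem sum_Dpos_eq_sum_cnt (c : ℝ) (a b : Dir) (s : Finset Dir) :
    ∑ z ∈ s, Dpos c a b z = ∑ k : Fin 4, ((s.filter fun z => pos a b z = k).card : ℝ) * colVal c k := by
  unfold Dpos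
  rw [← sum_fiberwise_of_maps_to (s := s) (t := (univ : Finset (Fin 4))) (g := fun z => pos a b z)
    (fun z _ => mem_univ _)]
  refine sum_congr rfl fun k _ => ?_
  rw [sum_congr rfl fun z hz => by rw [(mem_filter.1 hz).2], sum_const, nsmul_eq_mul]

/-- The same over the pair set. [folklore] -/
theorem sum_pairs_Dpos_eq_sum_cnt (c : ℝ) (x : Dir) :
    ∑ p ∈ pairSet x, Dpos c p.1 p.2 x =
      ∑ k : Fin 4, (((pairSet x).filter fun p => pos p.1 p.2 x = k).card : ℝ) * colVal c k := by
  unfold Dpos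
  rw [← sum_fiberwise_of_maps_to (s := pairSet x) (t := (univ : Finset (Fin 4)))
    (g := fun p => pos p.1 p.2 x) (fun p _ => mem_univ _)]
  refine sum_congr rfl fun k _ => ?_
  rw [sum_congr rfl fun p hp => by rw [(mem_filter.1 hp).2], sum_const, nsmul_eq_mul]

/-- `colVal` at the four classes. [folklore] -/
theorem colVal_zero (c : ℝ) : colVal c 0 = Dbb c := by simp [colVal]

/-- `colVal` at class `1`. [folklore] -/
theorem colVal_one (c : ℝ) : colVal c 1 = Dbbar c := by simp [colVal]

/-- `colVal` at class `2`. [folklore] -/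
theorem colVal_two (c : ℝ) : colVal c 2 = Dabar c := by simp [colVal]

/-- `colVal` at class `3`. [folklore] -/
theorem colVal_three (c : ℝ) : colVal c 3 = Dgen c := by simp [colVal]

/-- Unfolding a sum over `Fin 4` of the column values with given counts. [folklore] -/
theorem sum_fin4_colVal (c : ℝ) (n : Fin 4 → ℕ) :
    ∑ k : Fin 4, (n k : ℝ) * colVal c k =
      n 0 * Dbb c + n 1 * Dbbar c + n 2 * Dabar c + n 3 * Dgen c := by
  simp [Fin.sum_univ_four, colVal]

/-! ### The super-solution identity (hypothesis `hsol` of the window comparison) -/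

/-- **Column equation of Lemma G, abstract star.**  For non-collinear `a, b` (`a.1 ≠ b.1`), a star
link `x ≠ a`, and `0 ≤ c ≤ 7/40`:
`[x = b] + c · Σ_{z ≠ a, z.1 ≠ x.1} Dpos c a b z = Dpos c a b x` — the four cases are exactly
`colB_eq_b`, `colB_eq_bbar`, `colB_eq_abar`, `colB_eq_gen` after counting positions. [folklore] -/
theorem col_superSolution {c : ℝ} (h0 : 0 ≤ c) (h1 : c ≤ 7 / 40) {a b x : Dir} (hab : a.1 ≠ b.1)
    (hxa : x ≠ a) :
    (if x = b then (1 : ℝ) else 0) + c * ∑ z ∈ colSet a x, Dpos c a b z = Dpos c a b x := by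
  rw [sum_Dpos_eq_sum_cnt, sum_fin4_colVal]
  change (if x = b then (1 : ℝ) else 0) +
      c * ((cnt a b x 0 : ℝ) * Dbb c + (cnt a b x 1 : ℝ) * Dbbar c + (cnt a b x 2 : ℝ) * Dabar c +
        (cnt a b x 3 : ℝ) * Dgen c) = colVal c (pos a b x)
  by_cases hxb : x.1 = b.1
  · -- `x` is the partner `b` or its opposite
    obtain ⟨e0, e1, e2, e3⟩ := cnt_of_fst_eq a b x hab hxa hxb
    rw [e0, e1, e2, e3]
    by_cases hx : x = b
    · subst hx
      have hp : pos a x x = 0 := by simp [pos]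
      rw [if_pos rfl, hp, colVal_zero]
      push_cast
      linear_combination (-1 : ℝ) * colB_eq_b h0 h1
    · have hp : pos a b x = 1 := by simp [pos, hx, hxb]
      rw [if_neg hx, hp, colVal_one]
      push_cast
      linear_combination (-1 : ℝ) * colB_eq_bbar h0 h1
  · by_cases hxa1 : x.1 = a.1
    · -- `x` is opposite to the frozen link
      obtain ⟨e0, e1, e2, e3⟩ := cnt_of_fst_eq_fst a b x hab hxa hxa1
      have hx : x ≠ b := fun h => hxb (by rw [h])
      have hp : pos a b x = 2 := by simp [pos, hx, hxa1, hab]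
      rw [e0, e1, e2, e3, if_neg hx, hp, colVal_two]
      push_cast
      linear_combination (-1 : ℝ) * colB_eq_abar h0 h1
    · -- generic
      obtain ⟨e0, e1, e2, e3⟩ := cnt_of_generic a b x hab hxa1 hxb
      have hx : x ≠ b := fun h => hxb (by rw [h])
      have hp : pos a b x = 3 := by simp [pos, hx, hxb, hxa1]
      rw [e0, e1, e2, e3, if_neg hx, hp, colVal_three]
      push_cast
      linear_combination (-1 : ℝ) * colB_eq_gen h0 h1

/-! ### The count (hypothesis `hsum`: received sum `= R_G`) -/

/-- **The 48-position count, abstract star**: for every star link `x`,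
`Σ_{(a,b) : a.1 ≠ b.1, a ≠ x} Dpos c a b x = 6 D_bb + 6 D_āb + 6 D_b̄b + 24 D_gb`. [folklore] -/
theorem sum_pairs_Dpos (c : ℝ) (x : Dir) :
    ∑ p ∈ pairSet x, Dpos c p.1 p.2 x = 6 * Dbb c + 6 * Dabar c + 6 * Dbbar c + 24 * Dgen c := by
  rw [sum_pairs_Dpos_eq_sum_cnt, sum_fin4_colVal]
  obtain ⟨e0, e1, e2, e3⟩ := cnt2_eq x
  change (cnt2 x 0 : ℝ) * Dbb c + (cnt2 x 1 : ℝ) * Dbbar c + (cnt2 x 2 : ℝ) * Dabar c +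
      (cnt2 x 3 : ℝ) * Dgen c = _
  rw [e0, e1, e2, e3]
  push_cast
  ring

/-- **Received sum of the shared Lemma-G array equals `R_G(β)`**: with `c = β/4`, `0 ≤ β ≤ 7/10`,
`c · Σ_{(a,b) : a.1 ≠ b.1, a ≠ x} Dpos c a b x = gaugeR β` for every star link `x`
(each unordered pair carries two boundary links, each with weight `c/2` — so the per-link received
sum is `c ·` the ordered-pair sum). [folklore] -/
theorem received_sum_eq_gaugeR {β : ℝ} (h0 : 0 ≤ β) (h1 : β ≤ 7 / 10) (x : Dir) :
    (β / 4) * ∑ p ∈ pairSet x, Dpos (β / 4) p.1 p.2 x = gaugeR β := by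
  rw [sum_pairs_Dpos, gaugeR_eq_count h0 h1]

end Summit.Ventures.YMGap.StarColumn

end
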